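/-
Copyright: lit-balaban Phase-2 proof seat p30 (gen 6).  Statement-level skeleton of a published paper; no proof claims beyond what
the kernel checks below.
-/
import Literature.MathematicalPhysics.QuantumFieldTheory.BalabanImbrieJaffe1984to88.BIJ85Eq625Torus
import Literature.MathematicalPhysics.QuantumFieldTheory.BalabanImbrieJaffe1984to88.BIJ85Eq453GaugeField

/-!
# `BalabanImbrieJaffe1984to88.BIJ85Eq622Torus` — T. Bałaban, J. Imbrie, A. Jaffe, *Renormalization of the Higgs model: minimizers,
propagators and the stability of mean field theory*, Commun. Math. Phys. **97** (1985) 299–329 [BalabanImbrieJaffe1985]: Sect. 6.2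
**(6.2) ⇒ (6.2.2) AT GROUP LEVEL ON THE TORI, and (6.3.1) with `u`, `u_k`, `u_{k+1}`, `B` GIVEN BY THEIR PRINTED FORMULAS** — the
group-valued pull-backs `Q^{s*}` / `Q^{s*}_k` of (4.5.3) (seat p31's `BIJ85Eq453GaugeField.qsstarG` / `qsstarGIter0`, any group) read on
the U(1) bond fields `BIJ85Sect1Model.U1Field` of the model, their multiplicativity, the U(1) dictionary (4.5.2) = (4.5.3) for the base-0
composite `Q^{s*}_k` (`BIJ85Eq531Inputs.QsstarIter`), hence **(6.2.2)** *"By (6.2) we have Q^{s*}_ku = (Q^{s*}_{k+1}v)e^{ie_kηQ^{s*}_kB′}"*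
PROVED from (6.2) `u = u′Q^{s*}v, u′ = exp(ie_kB′)`, and the decomposition **(6.3.1)** `u_k = u_{k+1}e^{ie_kηH_kB}e^{iη∂ω}` of seat p30's
`BIJ85Eq625Torus.eq625_torus` with `u` := (6.2), `u_k` := (4.5.4) (= (6.2.1)), `u_{k+1}` := (4.5.4) at k+1 (before rescaling) and `B` :=
(6.1.8) substituted — the small-field decomposition (6.4) of `f^{(k)}` being the ONLY remaining hypothesis (it is the standing small-field
assumption of Sect. 6, p. 318: *"valid as long as u′(p) and (Q^{s*}_kv)(p) are close to 1"*; discharged under smallness by p31's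
`BIJ85Eq454Holonomy.eq64`)

statement-level skeleton of published theorems with citation tags; proofs where landed; nothing here is a claim about the Yang–Mills mass gap

PDF held: `paper:balaban1985-cmp97-bij-higgs-minimizers` (journal page = PDF page + 298).  Pages read as images: pp. 312–313, 318–320
[PDF 14–15, 20–22] (`HOME/lit-balaban-r15/pages/1985-cmp97-bij-higgs-minimizers-p014,p015,p020,p021,p022-x2.png`).

CITATION HEADER (lean-in-tree rule).  Part of the lit-balaban TYPED SKELETON (HOME `run/shared/lean/pub/lit-balaban/`), Phase-2
seat p30 (gen 6), unit `lit-balaban-p30`; WHAT IS REPRODUCED = rows **C1.Eq6.2.1-6.2.6** (members (6.2.1), (6.2.2)), **C1.Eq6.3.1-6.3.4**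
(member (6.3.1)) and **C1.Eq4.5.3** (U(1) instance, base-0 composite) of `HOME/SKELETON.md` (reader file `HOME/lit-balaban-r15/ROWS-C1.md`)
AT THE TORUS MODEL OF RECORD (kind «model-instance»).

THE PRINTED TEXT (verbatim).  p. 312 [PDF 14]: *"(Q^{s*}_kv)_b = 1 if b is strictly contained in a k-block (both endpoints belong to the
block), v_c if the η-lattice bond b belongs to the corridor of bonds connecting the two blocks B^k(c₋) and B^k(c₊). (4.5.3)"*; (4.5.2):
*"(Q^{s*}_kv)_b = exp((ie_kηQ^{s*}_kB)_b), b ∈ T_η"*; p. 313: *"(u_k)_b = (Q^{s*}_kv)_b exp[−ie_kη(𝒟_k∂^*Q^{e*}_kf^{(k)})_b]. (4.5.4)"*; p. 318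
[PDF 20]: *"on the unit lattice let u = u′Q^{s*}v, u′ = exp(ie_kB′). (6.2)"*; p. 319–320: *"Rewrite the definition of u_k (with u in place
of v), so u_k = Q^{s*}_ku exp(−ie_kη𝒟_k∂^*Q^{e*}_kf^{(k)}). (6.2.1) By (6.2) we have Q^{s*}_ku = (Q^{s*}_{k+1}v)e^{ie_kηQ^{s*}_kB′}, (6.2.2)"*;
p. 320: *"u_k = u_{k+1}e^{ie_kηH_kB}e^{iη∂ω}, (6.3.1) where ω denotes the gauge transformation (6.2.6)."*

THE TYPING.  `qsU1` / `qsU1Iter k` = p31's `qsstarG` / `qsstarGIter0 k` ((4.5.3), defined for configurations with values in any group)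
at the group `Circle`, as maps `U1Field P (k+1) → U1Field P k` / `U1Field P k → U1Field P 0` (the abbreviations only fix the value group
and the name `U1Field` of the carrier, on which the pointwise group structure lives); `e` = the unit-lattice coupling `e_k` of (6.2),
`η` with `ηL^k = 1` the fine lattice spacing in units of `T^{(k)}`, so that `E = exp(ie_kη ·)` of (6.2.1) is `expField (e*η) ∘ ofLp` as in
`BIJ85Eq625Torus`; the operators are those of `BIJ85Eq625Torus` (`DkE`, `GaxE`, `HkE`, `CE`, `D527E`, `lamE`, `QsE`, `QesOp`, `QesOne`,
`dOne`, `curlOp`, `gradV1`).  WHAT IS PROVED: §1 `qsU1_mul`, `qsU1Iter_mul` (the pull-back of group-valued fields is multiplicative),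
`qsU1Iter_succ` (`Q^{s*}_{k+1} = Q^{s*}_kQ^{s*}`); §2 **`expField_QsstarIter`** = the U(1) dictionary (4.5.2) = (4.5.3) for the base-0
composite: `exp(ie_kη(Q^{s*}_kB)) = Q^{s*}_k(exp(ie_kB))` (`ηL^k = 1`; one step = p31's `expField_Qsstar_eq_qsstarG`); §3 **`eq622_torus`**:
(6.2.2) from (6.2); §4 **`eq631_explicit`**: (6.3.1) = (6.2.5)–(6.2.6) on the tori for `u_k` and `u_{k+1}` DEFINED by (4.5.4) from `u` =
(6.2) and `v`, `B` DEFINED by (6.1.8), the sole hypothesis being (6.4).  D-0026: the two `abbrev`s are printed objects with bodies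
(instances of (4.5.3)); no new named fact.  Unit `lit-balaban-p30` (literature-prover-lit-balaban-p30-g6-0), 2026-08-21.
-/

open scoped BigOperators RealInnerProductSpace

namespace Literature.MathematicalPhysics.QuantumFieldTheory.BalabanImbrieJaffe1984to88.BIJ85Eq622Torus

open Literature.MathematicalPhysics.QuantumFieldTheory.Balaban1983to89
open LatticeFieldCalculus BIJ85Sect1Model BIJ85SmallFieldSplit64 BIJ85AxialPropagator411 BIJ85SigmaForm421 BIJ85UnitPropagator433
  BIJ85Prop521Proof BIJ85Prop521Torus BIJ85Sigma421Torus BIJ85Eq611Torus BIJ85LandauMinimizer442V1 BIJ85Prop511Torus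
  BIJ85Prop522Torus BIJ85Eq219Proof BIJ85Eq531Inputs BIJ85Eq453GaugeField BIJ85Eq625Torus

noncomputable section

variable {P : Params} {j : ℕ}

/-! ## 1. (4.5.3) on the U(1) bond fields of the model: one step and the base-0 composite -/

/-- **(4.5.3), one step, for U(1) fields**: the group-valued pull-back `Q^{s*}` from `T^{(j+1)}` to `T^{(j)}` — seat p31's `qsstarG` (any
value group) at the group `Circle`, as a map of the model's U(1) bond fields `U1Field` (on which the pointwise group structure lives).
[cite: BalabanImbrieJaffe1985, (4.5.3) p.312] -/
abbrev qsU1 (v : U1Field P (j + 1)) : U1Field P j := qsstarG (G := Circle) v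

/-- **(4.5.3) with k-blocks, for U(1) fields**: the composite `Q^{s*}_k` from the unit lattice `T^{(k)}` to the η-lattice `T^{(0)}` — seat
p31's `qsstarGIter0 k` at the group `Circle`, as a map `U1Field P k → U1Field P 0`. [cite: BalabanImbrieJaffe1985, (4.5.3) p.312] -/
abbrev qsU1Iter (k : ℕ) (u : U1Field P k) : U1Field P 0 := qsstarGIter0 (G := Circle) k u

/-- `Q^{s*}_0 = I`. [cite: BalabanImbrieJaffe1985, (4.5.3) p.312] -/
theorem qsU1Iter_zero (u : U1Field P 0) : qsU1Iter 0 u = u := rfl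

/-- `Q^{s*}_{k+1}v = Q^{s*}_k(Q^{s*}v)` (p31's `qsstarGIter0_succ`). [cite: BalabanImbrieJaffe1985, (4.5.3) p.312] -/
theorem qsU1Iter_succ (k : ℕ) (v : U1Field P (k + 1)) : qsU1Iter (k + 1) v = qsU1Iter k (qsU1 v) := rfl

/-- **the pull-back (4.5.3) is multiplicative**: `Q^{s*}(vw) = (Q^{s*}v)(Q^{s*}w)` bondwise (`1·1 = 1` inside blocks, `v_cw_c` on corridors).
[cite: BalabanImbrieJaffe1985, (4.5.3) p.312] -/
theorem qsU1_mul (v w : U1Field P (j + 1)) : qsU1 (v * w) = qsU1 v * qsU1 w := by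
  funext b
  rw [Pi.mul_apply, qsU1, qsU1, qsU1, qsstarG_apply, qsstarG_apply, qsstarG_apply]
  split_ifs with h
  · rw [mul_one]
  · rfl

/-- … and so is the composite `Q^{s*}_k`. [cite: BalabanImbrieJaffe1985, (4.5.3) p.312] -/
theorem qsU1Iter_mul : ∀ (k : ℕ) (v w : U1Field P k), qsU1Iter k (v * w) = qsU1Iter k v * qsU1Iter k w
  | 0, _, _ => rfl
  | k + 1, v, w => by
    rw [qsU1Iter_succ, qsU1Iter_succ, qsU1Iter_succ, qsU1_mul, qsU1Iter_mul k]

/-- the translation (6.2) `u = u′·w` (`BIJ85SmallFieldSplit64.translate62`) is the product in the group of U(1) fields.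
[cite: BalabanImbrieJaffe1985, (6.2) p.318] -/
theorem translate62_eq_mul (u' w : U1Field P j) : translate62 u' w = u' * w := rfl

/-- `exp(ie(A + B)) = exp(ieA)exp(ieB)` bondwise on `T^{(j)}`. [cite: BalabanImbrieJaffe1985, (4.5.1) p.312] -/
theorem expField_add (e : ℝ) (A B : PBond P j → ℝ) : expField e (A + B) = expField e A * expField e B := by
  funext b
  rw [Pi.mul_apply, expField, expField, expField, Pi.add_apply, mul_add, Circle.exp_add]

/-! ## 2. The U(1) dictionary (4.5.2) = (4.5.3) for the base-0 composite `Q^{s*}_k` -/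

/-- **(4.5.2) = (4.5.3) for U(1), base-0 composite**: for `v = exp(ie_kB)` on the unit lattice `T^{(k)}` and `ηL^k = 1`,
`exp(ie_kη(Q^{s*}_kB)_b) = (Q^{s*}_kv)_b` — the Lie-algebra composite `BIJ85Eq531Inputs.QsstarIter k` (factor `L^k`, (2.17)) exponentiated IS
the group-valued composite (*"The independence of the resulting transformation on this choice [of the branch] follows from the equivalent
definition"*, p. 312); by induction on k, one step = p31's `expField_Qsstar_eq_qsstarG` (with `e ↦ e/L`); standing range `k ≤ m + K`.
[cite: BalabanImbrieJaffe1985, (4.5.2) p.312] -/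
theorem expField_QsstarIter : ∀ (k : ℕ), k ≤ P.m + P.K → ∀ (e η : ℝ), η * (P.L : ℝ) ^ k = 1 →
    ∀ (B : PBond P k → ℝ), expField (e * η) (QsstarIter k B) = qsU1Iter k (expField e B)
  | 0, _, e, η, hη, B => by
    rw [pow_zero, mul_one] at hη
    rw [hη, mul_one]
    rfl
  | k + 1, hk, e, η, hη, B => by
    have hL : (P.L : ℝ) ≠ 0 := by have := P.hL.2; positivity
    have hη' : η * (P.L : ℝ) * (P.L : ℝ) ^ k = 1 := by rw [mul_assoc, ← pow_succ']; exact hη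
    have ih := expField_QsstarIter k (by omega) (e * (P.L : ℝ)⁻¹) (η * (P.L : ℝ)) hη' ((torusBlockBonds P k).Qsstar B)
    have he : e * (P.L : ℝ)⁻¹ * (η * (P.L : ℝ)) = e * η := by field_simp
    rw [he] at ih
    rw [QsstarIter_succ, qsU1Iter_succ, ih]
    congr 1
    funext b
    exact expField_Qsstar_eq_qsstarG hk e (P.L : ℝ)⁻¹ (inv_mul_cancel₀ hL) B b

/-- The same on the Euclidean carriers of `BIJ85Eq625Torus`: `E(Q^{s*}_kB′) = Q^{s*}_k(exp(ie_kB′))` with `E = expField (e*η) ∘ ofLp` and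
`Q^{s*}_k = QsE P k` on Lie-algebra fields. [cite: BalabanImbrieJaffe1985, (4.5.2) p.312] -/
theorem expField_ofLp_QsE {k : ℕ} (hk : k ≤ P.m + P.K) (e η : ℝ) (hη : η * (P.L : ℝ) ^ k = 1) (B' : CoarseSpace P k) :
    expField (e * η) (WithLp.ofLp (QsE P k B')) = qsU1Iter k (expField e (WithLp.ofLp B')) := by
  rw [← expField_QsstarIter k hk e η hη]
  rfl

/-! ## 3. (6.2) ⇒ (6.2.2) -/

/-- **(6.2.2) FROM (6.2), ON THE TORI, AT GROUP LEVEL** p. 320 [PDF 22], verbatim: *"By (6.2) we have Q^{s*}_ku = (Q^{s*}_{k+1}v)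
e^{ie_kηQ^{s*}_kB′}, (6.2.2)"* — for EVERY U(1) field `v` on the L-lattice `T^{(k+1)}` and every real `B′` on the unit lattice `T^{(k)}`, with
`u = u′Q^{s*}v`, `u′ = exp(ie_kB′)` ((6.2): `translate62 (expField e B′) (qsU1 v)`): `Q^{s*}_ku = (Q^{s*}_{k+1}v)·exp(ie_kηQ^{s*}_kB′)` — by
multiplicativity of `Q^{s*}_k`, `Q^{s*}_kQ^{s*} = Q^{s*}_{k+1}`, and the dictionary `expField_QsstarIter` (`ηL^k = 1`, `k + 1 ≤ m + K`).
[cite: BalabanImbrieJaffe1985, (6.2.2) p.320] -/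
theorem eq622_torus {k : ℕ} (hk : k + 1 ≤ P.m + P.K) (e η : ℝ) (hη : η * (P.L : ℝ) ^ k = 1) (B' : PBond P k → ℝ)
    (v : U1Field P (k + 1)) :
    qsU1Iter k (translate62 (expField e B') (qsU1 v)) = qsU1Iter (k + 1) v * expField (e * η) (QsstarIter k B') := by
  rw [translate62_eq_mul, qsU1Iter_mul, qsU1Iter_succ, mul_comm, expField_QsstarIter k (by omega) e η hη]

/-- (6.2.2) in the shape of the hypothesis `h622` of `BIJ85Eq625Torus.eq625_torus` (`Qsu = Qsv·E(Q^{s*}_kB′)` on the Euclidean carrier).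
[cite: BalabanImbrieJaffe1985, (6.2.2) p.320] -/
theorem eq622_torusE {k : ℕ} (hk : k + 1 ≤ P.m + P.K) (e η : ℝ) (hη : η * (P.L : ℝ) ^ k = 1) (B' : CoarseSpace P k)
    (v : U1Field P (k + 1)) :
    qsU1Iter k (translate62 (expField e (WithLp.ofLp B')) (qsU1 v)) =
      qsU1Iter (k + 1) v * expField (e * η) (WithLp.ofLp (QsE P k B')) := by
  rw [expField_ofLp_QsE (by omega) e η hη, translate62_eq_mul, qsU1Iter_mul, qsU1Iter_succ, mul_comm]

/-! ## 4. (6.3.1) with `u`, `u_k`, `u_{k+1}`, `B` given by (6.2), (4.5.4), (4.5.4)_{k+1}, (6.1.8) -/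

/-- **(6.3.1) = (6.2.5)–(6.2.6) ON THE TORI, EXPLICIT** p. 320 [PDF 22]: *"u_k = u_{k+1}e^{ie_kηH_kB}e^{iη∂ω}, (6.3.1) where ω denotes the
gauge transformation (6.2.6)"* — for EVERY U(1) field `v` on `T^{(k+1)}`, unit-lattice Lie-algebra field `B′`, L-lattice plaquette field
`f^{(k+1)}` and unit-lattice plaquette field `f^{(k)}` obeying the small-field decomposition (6.4) `f^{(k)} = ∂B′ + lQ^{e*}f^{(k+1)}` (`h64`, THE
ONLY HYPOTHESIS), with: `u := u′Q^{s*}v, u′ = exp(ie_kB′)` ((6.2)); `u_k := (Q^{s*}_ku)·E(−𝒟_k∂^*Q^{e*}_kf^{(k)})` ((6.2.1) = the definition (4.5.4)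
*"with u in place of v"*); `u_{k+1} := (Q^{s*}_{k+1}v)·E(−l𝒟_{k+1}∂^*Q^{e*}_{k+1}f^{(k+1)})` ((4.5.4) at k+1 in the k-th step's lattice, i.e.
before the rescaling that absorbs `l = L^{−d/2}`, T4 of gen 1); `B := B′ + lC^{(k)}H_k^*∂^*Q^{e*}_{k+1}f^{(k+1)}` ((6.1.8)); `ω = D(Q^{e*}_k∂B′) +
λ_k(H_kB) − lλ_k(H_kC^{(k)}H_k^*∂^*Q^{e*}_{k+1}f^{(k+1)})` ((6.2.6)); `E = exp(ie_kη ·)` (`expField (e*η) ∘ ofLp`, `ηL^k = 1`), `H_k = HkE` the Landau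
minimizer (4.4.2), `C^{(k)} = CE`, `𝒟 = DkE` (4.4.4), `D = D527E` (5.2.7), `λ_k = lamE` (5.1.13) — seat p30's `BIJ85Eq625Torus.eq625_torus`
(all operator inputs discharged there) with (6.2.2) now PROVED (`eq622_torusE`) and (6.2.1)/(6.1.8)/u_{k+1} definitional.  Standing range
`k + 1 ≤ m + K`, `c ≠ 0`, `w > 0`, `2 ≤ d`. [cite: BalabanImbrieJaffe1985, (6.3.1) p.320] -/
theorem eq631_explicit (hd : 2 ≤ P.d) {k : ℕ} (hk : k + 1 ≤ P.m + P.K) {c : ℝ} (hc : c ≠ 0) {w : ℝ} (hw : 0 < w)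
    (e η l : ℝ) (hη : η * (P.L : ℝ) ^ k = 1) (v : U1Field P (k + 1)) (B' : CoarseSpace P k)
    (fk : UnitPlaqSpace P k) (fL : UnitPlaqSpace P (k + 1)) (h64 : fk = dOne P k c B' + l • QesOne P hd k fL) :
    let u : U1Field P k := translate62 (expField e (WithLp.ofLp B')) (qsU1 v)
    let uk : U1Field P 0 := qsU1Iter k u * expField (e * η) (WithLp.ofLp
      (-(DkE P w c k (LinearMap.adjoint (curlOp (P := P) w c) (QesOp (P := P) hd w k fk)))))
    let uk1 : U1Field P 0 := qsU1Iter (k + 1) v * expField (e * η) (WithLp.ofLp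
      (-(l • DkE P w c (k + 1) (LinearMap.adjoint (curlOp (P := P) w c) (QesOp (P := P) hd w (k + 1) fL)))))
    let B : CoarseSpace P k := B' + l • CE P w c k (LinearMap.adjoint (HkE P w c k)
      (LinearMap.adjoint (curlOp (P := P) w c) (QesOp (P := P) hd w (k + 1) fL)))
    let ω : EuclideanSpace ℝ (Balaban1983to89.Site P 0) :=
      D527E P w c k (QesOp (P := P) hd w k (dOne P k c B')) + lamE P c k (HkE P w c k B)
        - l • lamE P c k (HkE P w c k (CE P w c k (LinearMap.adjoint (HkE P w c k)
            (LinearMap.adjoint (curlOp (P := P) w c) (QesOp (P := P) hd w (k + 1) fL)))))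
    uk = uk1 * expField (e * η) (WithLp.ofLp (HkE P w c k B)) * expField (e * η) (WithLp.ofLp (gradV1 P c ω)) := by
  intro u uk uk1 B ω
  exact eq625_torus hd hk hc hw (e * η) l uk uk1 (qsU1Iter k u) (qsU1Iter (k + 1) v) fk fL B' B rfl
    (eq622_torusE hk e η hη B' v) h64 rfl rfl

/-- **(6.2.1)–(6.2.2) combined** (the first line of the computation (6.2.3)): with `u` = (6.2), the background field (4.5.4) of `u` is
`u_k = (Q^{s*}_{k+1}v)·E(Q^{s*}_kB′)·E(−𝒟_k∂^*Q^{e*}_kf^{(k)})`. [cite: BalabanImbrieJaffe1985, (6.2.3) p.320] -/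
theorem eq621_622 {k : ℕ} (hk : k + 1 ≤ P.m + P.K) (w c : ℝ) (hd : 2 ≤ P.d) (e η : ℝ) (hη : η * (P.L : ℝ) ^ k = 1)
    (v : U1Field P (k + 1)) (B' : CoarseSpace P k) (fk : UnitPlaqSpace P k) :
    qsU1Iter k (translate62 (expField e (WithLp.ofLp B')) (qsU1 v)) * expField (e * η) (WithLp.ofLp
        (-(DkE P w c k (LinearMap.adjoint (curlOp (P := P) w c) (QesOp (P := P) hd w k fk))))) =
      qsU1Iter (k + 1) v * expField (e * η) (WithLp.ofLp (QsE P k B')) * expField (e * η) (WithLp.ofLp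
        (-(DkE P w c k (LinearMap.adjoint (curlOp (P := P) w c) (QesOp (P := P) hd w k fk))))) := by
  rw [eq622_torusE hk e η hη B' v]

end

end Literature.MathematicalPhysics.QuantumFieldTheory.BalabanImbrieJaffe1984to88.BIJ85Eq622Torus
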